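import Summits.QuantumFields.YangMills.Theorems.FlatTubeReductionNormalisedProfile
import HarnessLib

/-!
# THE NORMALISED PROFILE PACKAGE of «ratepack-v3», with the NORMALISER EXPORTED: `normalisedProfile_package_n` = `…NormalisedProfile.normalisedProfile_package` verbatim plus three
# conjuncts on `n_β` itself — measurable, `0 ≤ n_β ≤ 1`, gauge invariant (one site) — for every `β`
# (route `FlatTubeReduction`, crux K1 `NearFlatRatioLaw` stmt-QuantumFields-24720; seat `ym-line-ftr-p1` g15; rate twin «ratepack-v3 / frozen fibres»; R2b1 RECORD rung — no summit
# statement is proved here)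

WHY (NOTES T7a).  The dressed (B-T) brick `hT` of `RateTube.AnalyticRatePotInput` is assembled from a POINTWISE kernel comparison through `…TubeFormNearFarNormalised.
tubeForm_boFunAd_normalised_near_of_nearFar`, which reads the profile as `Ω_β(u,x) = n_β(u)·Ω₀_β(x)` and needs the normaliser `n_β` as a function in its own right: measurable,
`|n_β| ≤ 1`, gauge invariant — and its SIGN (`0 ≤ n_β`), because the dressing exchange `√F(u,u)·n_β(u) = √(F(1,1)/2)·W_β(u)(1 + O(ε_W))` is between nonnegative functions.  The landed
package exports only facts about the product `n_β·Ω₀_β` (and `n_β²·m̃_β = ½`), which do not determine the sign of `n_β`.  This file re-runs the SAME construction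
(`n = min(1, √(γ/mass))`) and exports the three extra conjuncts; nothing else changes.
  ★★★ `normalisedProfile_package_n`.
HONEST FRAMING: bookkeeping (a strengthened restatement of a landed package with the same proof); femto rung R2b1 (RECORD label); not infinite volume, not a gap, not Clay.  No defs,
no named facts, no `sorry`.
-/

set_option autoImplicit false

noncomputable section

open MeasureTheory Filter Topology Real
open scoped BigOperators
open Literature.MathematicalPhysics.QuantumFieldTheory
open Literature.MathematicalPhysics.QuantumLattice

namespace Summit.QuantumFields.YangMills.Theorems.FemtoTransferGap.RateTube

open Summit.QuantumFields.YangMills.Theorems.FemtoTransferGap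
open Summit.QuantumFields.YangMills.Theorems.FemtoTransferGap.TwoLattice.ConstTube
open Summit.QuantumFields.YangMills.Theorems.FemtoTransferGap.TwoLattice.Avg
open Summit.QuantumFields.YangMills.Theorems.FemtoTransferGap.TwoLattice.Stiff (LinkSpace)

variable {L : ℕ} [NeZero L]

set_option maxHeartbeats 1600000 in
/-- ★★★ **THE NORMALISED PROFILE PACKAGE, normaliser exported** (the conjuncts of `normalisedProfile_package`, then: `n_β` measurable, `0 ≤ n_β ≤ 1`, `n_β` gauge invariant). [cite: Luscher1983, §3] -/
theorem normalisedProfile_package_n (hL : Nonempty (NzSite L)) {D : ℝ} (hD : 0 ≤ D) {Ω₀ : ℝ → LinkSpace L → ℝ} {R : ℝ → ℝ}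
    (hΩm : ∀ β, Measurable (Ω₀ β)) (hΩ1 : ∀ β x, |Ω₀ β x| ≤ 1) (hΩinv : ∀ β (g : SU2) (x : LinkSpace L), Ω₀ β (adL L g x) = Ω₀ β x)
    (hΩR : ∀ β x, Ω₀ β x ≠ 0 → ‖x‖ ≤ R β) (hR0 : ∀ᶠ β in atTop, 0 < R β) (hRsmall : ∀ᶠ β in atTop, 12 * Fintype.card (Site 3 L) * R β < powScale (1 / 6) β)
    (hR1 : ∀ᶠ β in atTop, R β ^ 2 ≤ powScale 1 β) (hγ : ∀ᶠ β in atTop, 0 < recordGamma L Ω₀ β) :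
    ∃ M₀ : ℝ, 2 ≤ M₀ ∧ ∀ M : ℝ, M₀ ≤ M → ∃ (n m : ℝ → GaugeConfig 3 1 SU2 → ℝ) (γ : ℝ → ℝ) (κN a : ℝ), 0 ≤ κN ∧ 0 ≤ a ∧
      (∀ β, Measurable (Function.uncurry fun u x => n β u * Ω₀ β x)) ∧ (∀ β u x, |n β u * Ω₀ β x| ≤ 1) ∧
      (∀ β (g : SU2) (u : GaugeConfig 3 1 SU2) (v : LinkSpace L), n β (gaugeTransform (fun _ : Site 3 1 => g) u) * Ω₀ β (adL L g v) = n β u * Ω₀ β v) ∧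
      (∀ β u x, n β u * Ω₀ β x ≠ 0 → ‖x‖ ≤ R β) ∧
      (∀ β, 0 < γ β) ∧
      (∀ᶠ β in atTop, ∀ u : GaugeConfig 3 1 SU2, orbitDist u < D * recordDelta1 L (1 / 6) β →
        fibreMassAd L (softWeight (recordChi L (1 / 6) (42 * D + 1) M β)) (fun u x => n β u * Ω₀ β x) u = γ β) ∧
      (∀ β, Measurable (m β)) ∧ (∀ β (g : Site 3 1 → SU2) (u : GaugeConfig 3 1 SU2), m β (gaugeTransform g u) = m β u) ∧
      (∀ β (k : Fin 3), ∀ z ∈ Subgroup.center SU2, ∀ u : GaugeConfig 3 1 SU2, m β (twist k z u) = m β u) ∧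
      (∀ᶠ β in atTop, ∀ u : GaugeConfig 3 1 SU2, orbitDist u < D * recordDelta1 L (1 / 6) β →
        |m β u - 1| ≤ κN * orbitDist u ^ 2 + a * bareLambda ((L : ℝ) ^ 3 * β) ^ 2 ∧ 0 < m β u ∧ n β u ^ 2 * m β u = 1 / 2) ∧
      (∀ β, Measurable (n β)) ∧ (∀ β u, 0 ≤ n β u ∧ n β u ≤ 1) ∧ (∀ β (g : Site 3 1 → SU2) (u : GaugeConfig 3 1 SU2), n β (gaugeTransform g u) = n β u) := by
  obtain ⟨M₀, hM₀, hrec⟩ := fibreMass_pointwise_record hL hD hΩm hΩ1 hΩR hR0 hRsmall hR1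
  refine ⟨M₀, hM₀, fun M hM => ?_⟩
  obtain ⟨κN, a, β₀, hκN, ha, hβ₀⟩ := hrec M hM
  -- the mass, the constant `γ`, the normaliser `n`, the raw ratio `mh`
  obtain ⟨mass, hmass⟩ : ∃ mass : ℝ → GaugeConfig 3 1 SU2 → ℝ, mass = fun β u => fibreMass L (softWeight (recordChi L (1 / 6) (42 * D + 1) M β)) (Ω₀ β) u := ⟨_, rfl⟩
  obtain ⟨γ, hγdef⟩ : ∃ γ : ℝ → ℝ, γ = fun β => if 0 < mass β 1 then mass β 1 / 2 else 1 := ⟨_, rfl⟩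
  obtain ⟨n, hndef⟩ : ∃ n : ℝ → GaugeConfig 3 1 SU2 → ℝ, n = fun β u => min 1 (Real.sqrt (γ β / mass β u)) := ⟨_, rfl⟩
  obtain ⟨mh, hmh⟩ : ∃ mh : ℝ → GaugeConfig 3 1 SU2 → ℝ, mh = fun β u => mass β u / mass β 1 := ⟨_, rfl⟩
  have hwm : ∀ β, Measurable (softWeight (recordChi L (1 / 6) (42 * D + 1) M β)) := fun β => (softWeight_recordChi_props (L := L) (1 / 6) (42 * D + 1) M β).1
  have hmass_m : ∀ β, Measurable (mass β) := fun β => by rw [hmass]; exact measurable_fibreMass (hwm β) (hΩm β)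
  have hmass_g : ∀ β (g : Site 3 1 → SU2) (u : GaugeConfig 3 1 SU2), mass β (gaugeTransform g u) = mass β u := fun β g u => by
    simp only [hmass]; exact fibreMass_recordChi_gaugeTransform _ _ _ _ (hΩm β) (hΩinv β) g u
  have hmass_c : ∀ β (g : SU2) (u : GaugeConfig 3 1 SU2), mass β (gaugeTransform (fun _ : Site 3 1 => g) u) = mass β u := fun β g u => hmass_g β _ u
  have hγpos : ∀ β, 0 < γ β := fun β => by
    simp only [hγdef]; split_ifs with h
    · linarith
    · norm_num
  -- the normaliser: measurable, `0 ≤ n ≤ 1`, colour invariant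
  have hn_m : ∀ β, Measurable (n β) := fun β => by rw [hndef]; exact measurable_const.min (measurable_const.div (hmass_m β)).sqrt
  have hn1 : ∀ β u, |n β u| ≤ 1 := fun β u => by
    simp only [hndef]
    rw [abs_of_nonneg (le_min zero_le_one (Real.sqrt_nonneg _))]; exact min_le_left _ _
  have hn_c : ∀ β (g : SU2) (u : GaugeConfig 3 1 SU2), n β (gaugeTransform (fun _ : Site 3 1 => g) u) = n β u := fun β g u => by simp only [hndef, hmass_c]
  have hn_g : ∀ β (g : Site 3 1 → SU2) (u : GaugeConfig 3 1 SU2), n β (gaugeTransform g u) = n β u := fun β g u => by simp only [hndef, hmass_g]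
  have hn01 : ∀ β u, 0 ≤ n β u ∧ n β u ≤ 1 := fun β u => by
    simp only [hndef]; exact ⟨le_min zero_le_one (Real.sqrt_nonneg _), min_le_left _ _⟩
  -- (i) structural fields of the scaled profile, for every `β`
  have hstruct := fun β => scaledProfile_props (Ω := fun _ x => Ω₀ β x) ((hΩm β).comp measurable_snd) (fun _ x => hΩ1 β x) (fun g _ v => hΩinv β g v)
    (fun _ x hx => hΩR β x hx) (hn_m β) (hn1 β) (hn_c β)
  -- (iii) the physical extension of the raw ratio
  have hmh_m : ∀ β, Measurable (mh β) := fun β => by rw [hmh]; exact (hmass_m β).div measurable_const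
  have hmh_g : ∀ β (g : Site 3 1 → SU2) (u : GaugeConfig 3 1 SU2), mh β (gaugeTransform g u) = mh β u := fun β g u => by simp only [hmh, hmass_g]
  obtain ⟨m, hm_m, hm_g, hm_t, hm_w, -⟩ := exists_phys_extension (L := 1) (m := mh) hmh_m hmh_g (δ₁ := fun β => min (D * recordDelta1 L (1 / 6) β) 1)
    (fun β => by simp only [Nat.cast_one, one_mul]; exact lt_of_le_of_lt (min_le_right _ _) (by norm_num))
  -- the eventual good set
  have hδt : Tendsto (fun β => D * recordDelta1 L (1 / 6) β) atTop (𝓝 0) := by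
    simpa using (tendsto_recordDelta1 (L := L) (by norm_num : (0 : ℝ) < 1 / 6)).const_mul D
  have hev : ∀ᶠ β in atTop, β₀ ≤ β ∧ 0 < recordGamma L Ω₀ β ∧ D * recordDelta1 L (1 / 6) β ≤ 1 ∧ κN * (D * recordDelta1 L (1 / 6) β) ≤ 1 / 4 ∧
      a * bareLambda ((L : ℝ) ^ 3 * β) ^ 2 ≤ 1 / 4 := by
    filter_upwards [Filter.eventually_ge_atTop β₀, hγ, hδt.eventually (eventually_le_nhds (by norm_num : (0:ℝ) < 1)),
      eventually_mul_le_of_tendsto hδt κN (by norm_num : (0:ℝ) < 1 / 4), mul_bareLambda_sq_eventually_le (L := L) ha] with β h1 h2 h3 h4 h5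
    exact ⟨h1, h2, h3, h4, h5⟩
  -- what holds on the good set, for `u` in the window
  have hgood : ∀ β, (β₀ ≤ β ∧ 0 < recordGamma L Ω₀ β ∧ D * recordDelta1 L (1 / 6) β ≤ 1 ∧ κN * (D * recordDelta1 L (1 / 6) β) ≤ 1 / 4 ∧
      a * bareLambda ((L : ℝ) ^ 3 * β) ^ 2 ≤ 1 / 4) → ∀ u : GaugeConfig 3 1 SU2, orbitDist u < D * recordDelta1 L (1 / 6) β →
      0 < mass β 1 ∧ γ β = mass β 1 / 2 ∧ |mh β u - 1| ≤ κN * orbitDist u ^ 2 + a * bareLambda ((L : ℝ) ^ 3 * β) ^ 2 ∧ γ β ≤ mass β u ∧ 0 < mass β u ∧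
        m β u = mh β u ∧ n β u = Real.sqrt (γ β / mass β u) := by
    rintro β ⟨hβ, hΓ, hδ1, hκδ, hal⟩ u hu
    obtain ⟨-, hratio⟩ := hβ₀ β hβ u hu.le
    obtain ⟨hpos, hq⟩ := hratio hΓ
    have hpos' : 0 < mass β 1 := by rw [hmass]; exact hpos
    have hγe : γ β = mass β 1 / 2 := by simp only [hγdef, hpos', if_true]
    have hq' : |mh β u - 1| ≤ κN * orbitDist u ^ 2 + a * bareLambda ((L : ℝ) ^ 3 * β) ^ 2 := by simp only [hmh, hmass]; exact hq
    have hd0 := orbitDist_nonneg u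
    have hd2 : κN * orbitDist u ^ 2 ≤ 1 / 4 := by
      have : orbitDist u ^ 2 ≤ D * recordDelta1 L (1 / 6) β := by nlinarith only [hu, hd0, hδ1]
      nlinarith only [this, hκN, hκδ]
    have hhalf : 1 / 2 ≤ mh β u := by have := (abs_le.mp hq').1; linarith
    have hmu : γ β ≤ mass β u := by
      have e : mh β u = mass β u / mass β 1 := by simp only [hmh]
      rw [e, le_div_iff₀ hpos'] at hhalf
      rw [hγe]; linarith
    have hmu0 : 0 < mass β u := lt_of_lt_of_le (hγpos β) hmu
    have hwin : orbitDist u < min (D * recordDelta1 L (1 / 6) β) 1 := lt_min hu (lt_of_lt_of_le hu hδ1)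
    have hne : n β u = Real.sqrt (γ β / mass β u) := by
      simp only [hndef]
      exact min_eq_right (Real.sqrt_le_one.mpr ((div_le_one hmu0).mpr hmu) |>.trans le_rfl)
    exact ⟨hpos', hγe, hq', hmu, hmu0, hm_w β u hwin, hne⟩
  refine ⟨n, m, γ, κN, a, hκN, ha, fun β => (hstruct β).1, fun β u x => (hstruct β).2.1 u x, fun β g u v => (hstruct β).2.2.1 g u v,
    fun β u x h => (hstruct β).2.2.2 u x h, hγpos, ?_, hm_m, hm_g, hm_t, ?_, hn_m, hn01, hn_g⟩
  · -- (ii) exact fibre mass on the window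
    filter_upwards [hev] with β hβ u hu
    obtain ⟨-, -, -, hmu, -, -, hne⟩ := hgood β hβ u hu
    have hfm : fibreMassAd L (softWeight (recordChi L (1 / 6) (42 * D + 1) M β)) (fun _ x => Ω₀ β x) u = mass β u := by
      rw [hmass]; unfold fibreMassAd fibreMass; rfl
    have hmu' : γ β ≤ fibreMassAd L (softWeight (recordChi L (1 / 6) (42 * D + 1) M β)) (fun _ x => Ω₀ β x) u := by rw [hfm]; exact hmu
    have hne' : n β u = Real.sqrt (γ β / fibreMassAd L (softWeight (recordChi L (1 / 6) (42 * D + 1) M β)) (fun _ x => Ω₀ β x) u) := by rw [hfm]; exact hne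
    exact (fibreMassAd_normalise (Ω := fun _ x => Ω₀ β x) (hγpos β) hmu' (n := n β) hne').1
  · -- (iii) the ratio on the window
    filter_upwards [hev] with β hβ u hu
    obtain ⟨hpos, hγe, hq, -, hmu0, hmw, hne⟩ := hgood β hβ u hu
    have hmh0 : 0 < mh β u := by simp only [hmh]; exact div_pos hmu0 hpos
    refine ⟨by rw [hmw]; exact hq, by rw [hmw]; exact hmh0, ?_⟩
    rw [hmw, hne, Real.sq_sqrt (div_nonneg (hγpos β).le hmu0.le), hγe]
    simp only [hmh]
    field_simp

end Summit.QuantumFields.YangMills.Theorems.FemtoTransferGap.RateTube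

end
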